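import Mathlib
import HarnessLib
import Literature.Analysis.Distribution.SmoothCutoff

/-!
# Route `PoloidalWindowDoor`, crux `PoloidalWindowRigidity` (K2, stmt-NavierStokesRegularity-19708) — preliminaries for
# the HOT-LOOP LEMMA (stub HL1 `stub_hotLoop` of line `hot_loops`, ns-idea-8 g6): cutoffs around a compact set and a
# first-exit point along a ray

Cell ns-regularity-ideate, seat ns-poloidal-K2-p2 g11 (stub-worker on K2; `--supports` the crux item).

* `exists_cutoff_infDist` — a `C^∞` function with values in `[0,1]`, `= 1` where `infDist · K < u` and `= 0` where
  `3u ≤ infDist · K` (Hörmander's cutoff, tree `Literature.Analysis.Distribution.exists_smooth_cutoff`);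
* `exists_first_exit` — for a continuous `g : ℝ → ℝ` with `g 0 < a ≤ g S`, `S > 0`: the first parameter `s₁ ∈ (0, S]`
  with `g s₁ = a`, before which `g < a`;
* `norm_le_of_infDist_lt` — points close to a bounded set are bounded.

WHAT THIS IS NOT: not a claim about Navier–Stokes — elementary topology for one provable stub of an ideator line of a
door route (bears_on LADDER-NS N0, rung N0-LocalTubeDoorPoloidal).
-/

noncomputable section

-- the summit and its single sub-problem share the name (CONVENTIONS §1), as in every Theorems file
set_option linter.dupNamespace false

namespace Summit.NavierStokesRegularity.NavierStokesRegularity.Theorems.PoloidalWindowDoorPoloidalWindowRigidityHotLoopPrelim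

open Set Function Filter Topology Metric
open Literature.Analysis.Distribution

/-- **Smooth cutoff around a set, in terms of `infDist`.**  For a nonempty set `K ⊂ ℝ³` and `u > 0` there is
`χ ∈ C^∞(ℝ³)`, `0 ≤ χ ≤ 1`, with `χ = 1` wherever `infDist · K < u` and `χ = 0` wherever `3u ≤ infDist · K`. -/
theorem exists_cutoff_infDist {K : Set (EuclideanSpace ℝ (Fin 3))} (hK : K.Nonempty) {u : ℝ} (hu : 0 < u) :
    ∃ χ : EuclideanSpace ℝ (Fin 3) → ℝ, ContDiff ℝ (⊤ : ℕ∞) χ ∧ (∀ y, 0 ≤ χ y) ∧ (∀ y, χ y ≤ 1) ∧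
      (∀ y, infDist y K < u → χ y = 1) ∧ (∀ y, 3 * u ≤ infDist y K → χ y = 0) := by
  obtain ⟨χ, hχs, hχ0, hχ1, hone, hsupp, -⟩ := exists_smooth_cutoff K hu
  refine ⟨χ, hχs, hχ0, hχ1, fun y hy => hone y ((mem_thickening_iff_infDist_lt hK).2 hy), fun y hy => ?_⟩
  apply image_eq_zero_of_notMem_tsupport
  intro hmem
  have h := (mem_thickening_iff_infDist_lt hK).1 (hsupp hmem)
  linarith

/-- **First exit along a parameter.**  `g : ℝ → ℝ` continuous, `g 0 < a`, `a ≤ g S`, `0 < S`: there is `s₁ ∈ (0, S]`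
with `g s₁ = a` and `g s < a` for `0 ≤ s < s₁`. -/
theorem exists_first_exit {g : ℝ → ℝ} (hg : Continuous g) {a S : ℝ} (hS : 0 < S) (h0 : g 0 < a) (hSa : a ≤ g S) :
    ∃ s₁ : ℝ, 0 < s₁ ∧ s₁ ≤ S ∧ g s₁ = a ∧ ∀ s, 0 ≤ s → s < s₁ → g s < a := by
  set T : Set ℝ := {s | 0 ≤ s ∧ s ≤ S ∧ a ≤ g s} with hT
  have hTclosed : IsClosed T := by
    rw [hT, setOf_and, setOf_and]
    exact (isClosed_le continuous_const continuous_id).inter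
      ((isClosed_le continuous_id continuous_const).inter (isClosed_le continuous_const hg))
  have hTne : T.Nonempty := ⟨S, hS.le, le_rfl, hSa⟩
  have hTbdd : BddBelow T := ⟨0, fun s hs => hs.1⟩
  set s₁ := sInf T with hs₁
  have hs₁T : s₁ ∈ T := hTclosed.csInf_mem hTne hTbdd
  have hbelow : ∀ s, 0 ≤ s → s < s₁ → g s < a := by
    intro s hs0 hss
    by_contra hge
    rw [not_lt] at hge
    have hsT : s ∈ T := ⟨hs0, (hss.le.trans hs₁T.2.1), hge⟩
    exact (not_le.2 hss) (csInf_le hTbdd hsT)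
  have hs₁pos : 0 < s₁ := by
    rcases hs₁T.1.lt_or_eq with h | h
    · exact h
    · exfalso; rw [← h] at hs₁T; linarith [hs₁T.2.2]
  -- continuity from the left: `g s₁ ≤ a`
  have hle : g s₁ ≤ a := by
    have ht : Tendsto g (𝓝[<] s₁) (𝓝 (g s₁)) := (hg.tendsto s₁).mono_left nhdsWithin_le_nhds
    refine le_of_tendsto ht ?_
    filter_upwards [Ioo_mem_nhdsLT hs₁pos] with s hs
    exact (hbelow s hs.1.le hs.2).le
  exact ⟨s₁, hs₁pos, hs₁T.2.1, le_antisymm hle hs₁T.2.2, hbelow⟩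

/-- Points within `infDist < u` of a set contained in `closedBall y₀ R₀` lie within `R₀ + u` of
`y₀` (strictly). -/
theorem dist_lt_of_infDist_lt {K : Set (EuclideanSpace ℝ (Fin 3))} (hK : K.Nonempty) {y₀ : EuclideanSpace ℝ (Fin 3)}
    {R₀ : ℝ} (hKR : K ⊆ closedBall y₀ R₀) {y : EuclideanSpace ℝ (Fin 3)} {u : ℝ} (hy : infDist y K < u) :
    dist y y₀ < R₀ + u := by
  obtain ⟨k, hk, hyk⟩ := (infDist_lt_iff hK).1 hy
  have hk' : dist k y₀ ≤ R₀ := mem_closedBall.1 (hKR hk)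
  linarith [dist_triangle y k y₀]

/-- Along the ray `y₀ + s•e` (`‖e‖ = 1`) from a point `y₀` of a set `K ⊆ closedBall y₀ R₀`, the parameter `S = R₀ + u`
is at `infDist ≥ u` from `K`. -/
theorem le_infDist_ray {K : Set (EuclideanSpace ℝ (Fin 3))} (hK : K.Nonempty) {y₀ e : EuclideanSpace ℝ (Fin 3)}
    (he : ‖e‖ = 1) {R₀ u : ℝ} (hKR : K ⊆ closedBall y₀ R₀) :
    u ≤ infDist (y₀ + (R₀ + u) • e) K := by
  by_contra hlt
  rw [not_le] at hlt
  have h := dist_lt_of_infDist_lt hK hKR hlt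
  rw [dist_eq_norm, add_sub_cancel_left, norm_smul, he, mul_one, Real.norm_eq_abs] at h
  linarith [le_abs_self (R₀ + u)]

end Summit.NavierStokesRegularity.NavierStokesRegularity.Theorems.PoloidalWindowDoorPoloidalWindowRigidityHotLoopPrelim

end
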